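import Summits.CriticalPhenomena.PercolationContinuityZ3.Theorems.Transplant.SiteKNStepII
import Summits.CriticalPhenomena.PercolationContinuityZ3.Theorems.Transplant.SiteKNStepIV
import Summits.CriticalPhenomena.PercolationContinuityZ3.Theorems.Transplant.SiteKNStepV
import Summits.CriticalPhenomena.PercolationContinuityZ3.Theorems.Transplant.SiteKNTransfer
import HarnessLib

/-!
# SITE Kozma–Nitzan §4 — Lemma 10 (the site target lemma), assembled from Steps I–V
# (site twin of `KozmaNitzan.targetLemma_avoiding` / `targetLemma`, `L/KozmaNitzanTargetLemma.lean` ll. 2107–2343)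

builds on p205010 (kernel theorem, internal audit signed; external expert review pending).
Lane `prim-bschramm`, class C1a (site percolation on `ℤ³`), seat p1 gen 3, block (α) of the SITE same-`p` witness
(`SiteSameP.SiteSamePWitnessZd`, socket p217536).  Helper file (`--supports stmt-CriticalPhenomena-4575`).

**`siteTargetLemma_of_face`** — KN Lemma 10 for SITE percolation on `ℤ^d`: assume `0 < p < 1` and the site full-face
estimate `hface` (Grimmett (7.14)–(7.16) for site percolation: `Λ_k ↔^{site} orthantFace in Λ_n` with probability close to
one for `k` large and all large `n`, every face orthant — the site twin of `GMFiniteSize.exists_forall_lt_real_linked_orthantFace`,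
block (α4), the only place where `θ^{site}(p) > 0` enters).  Then for every `ε > 0` there is `δ > 0` such that for every
finite family `H` of site-hittable geometries there is `R` with: for every finitely supported vertex weighting `w` of `ℤ^d`
with a site subbox `D ⊇ B⟨R⟩` at parameter `p` (`B = Icc lo hi`), every nonempty target `T ⊆ D` w.r.t. `(B, D, R, H)` and
every source `o ∉ D`, `P_w(o ↔^{site} B) > 1 − δ ⟹ P_w(o ↔^{site} T) > 1 − ε`.
Proof: Steps I–V verbatim in site form — `SLHyp.stepII`, `SLHyp.real_manyContacts_diff_sGev_le`, `stepIV_in`,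
`SLHyp.stepV_in` — with site Lemma 7 := `exists_forall_le_lt_real_siteUniqZoneAt` (from S1) and the site gluing
hypothesis := `siteGluing_avoiding` (from SITE KN Conjecture 3, `SiteCSH.siteNearOneGluing_holds`, p215077), in the
avoiding form (relays reliable to `T` inside `D ∌ o`).
[cite: KozmaNitzan2024, §4 Lemma 10 (pp. 17–22); p. 16 (targets, hittable geometries)] [cite: GrimmettPercolation1999, §7.2 (7.14)–(7.16)]
-/

noncomputable section

namespace Summit.CriticalPhenomena.PercolationContinuityZ3.Theorems.Transplant

namespace SiteKN

open MeasureTheory ProbabilityTheory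
open Literature.Probability.Percolation Literature.Probability.LatticeModels
open Literature.Probability.Percolation.KozmaNitzan
open SiteTransplant (siteConn mem_siteConn)

variable {d : ℕ}

/-- **SITE Kozma–Nitzan Lemma 10 (the site target lemma), given the site full-face estimate.**
[cite: KozmaNitzan2024, §4 Lemma 10 (pp. 17–22)] -/
theorem siteTargetLemma_of_face [NeZero d] (p : unitInterval) (hp0 : 0 < (p : ℝ)) (hp1 : (p : ℝ) < 1)
    (hface : ∀ η : ℝ, 0 < η → ∀ k₀ : ℕ, ∃ k : ℕ, k₀ ≤ k ∧ ∃ n₁ : ℕ, k < n₁ ∧ ∀ n, n₁ ≤ n →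
      ∀ (a : Fin d) (τ : Fin d → ℤˣ),
        1 - η < (sitePercolation (Site d) p).real (siteLinkIn (↑(box d n)) (box d k) (orthantFace a τ n)))
    {ε : ℝ} (hε : 0 < ε) :
    ∃ δ : ℝ, 0 < δ ∧ ∀ H : List (Geom d), (∀ g ∈ H, SiteIsHittable p g) → ∃ R : ℕ,
      ∀ (w : Site d → unitInterval) (Sfin D : Finset (Site d)) (lo hi : Site d)
        (T : Finset (Site d)) (o : Site d),
        SiteFinSupp w Sfin → SiteIsSubbox w p D → D ⊆ Sfin → o ∈ Sfin → o ∉ D →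
        Finset.Icc (lo - (R : Site d)) (hi + (R : Site d)) ⊆ D →
        IsTarget T lo hi D R H → T ⊆ D → T.Nonempty →
        1 - δ < (prodBernoulli w).real (⋃ b ∈ Finset.Icc lo hi, siteConn (zdGraph d) o b) →
          1 - ε < (prodBernoulli w).real (⋃ t ∈ T, siteConn (zdGraph d) o t) := by
  classical
  -- trivial when `ε > 1`
  rcases le_or_gt ε 1 with hε1 | hε1
  swap
  · refine ⟨1, one_pos, fun H _ => ⟨0, fun w Sfin D lo hi T o _ _ _ _ _ _ _ _ _ _ => ?_⟩⟩
    exact lt_of_lt_of_le (by linarith) measureReal_nonneg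
  -- Step I: the constants `δ_{C3}`, `δ`
  obtain ⟨δ₀, hδ₀, hC3⟩ := siteGluing_avoiding (ε := ε / 2) (half_pos hε)
  set δc : ℝ := min δ₀ 1 with hδc
  have hδc0 : 0 < δc := lt_min hδ₀ one_pos
  have hδc1 : δc ≤ 1 := min_le_right _ _
  set δ : ℝ := ε * δc / 12 with hδdef
  have hδpos : 0 < δ := by positivity
  have hδc' : δ ≤ δc := by rw [hδdef]; nlinarith
  have h3δ : 3 * δ ≤ 1 := by rw [hδdef]; nlinarith
  have h12 : 12 * δ ≤ ε * δc := by rw [hδdef]; linarith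
  refine ⟨δ, hδpos, fun H hH => ?_⟩
  -- the scales `m`, `M`
  have hη : 0 < δ ^ 2 := by positivity
  have hkl : ∀ g ∈ H, ∃ kl : ℕ × ℕ, ∀ m, kl.1 ≤ m → ∀ ℓ, kl.2 ≤ ℓ →
      1 - δ ^ 2 < (sitePercolation (Site d) p).real (siteLinkIn (↑(g.Qset ℓ 0)) (box d m) (g.Fset ℓ 0)) := by
    intro g hg
    obtain ⟨k, ℓ₀, h⟩ := (hH g hg).hit (δ ^ 2) hη
    exact ⟨(k, ℓ₀), h⟩
  choose! kl hklspec using hkl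
  have le_foldr_max_of_mem : ∀ {l : List ℕ} {a : ℕ}, a ∈ l → a ≤ l.foldr max 0 := by
    intro l
    induction l with
    | nil => intro a h; exact absurd h List.not_mem_nil
    | cons b l ih =>
      intro a h
      rw [List.foldr_cons]
      rcases List.mem_cons.1 h with rfl | h
      · exact le_max_left _ _
      · exact (ih h).trans (le_max_right _ _)
  set k₀ := (H.map fun g => (kl g).1).foldr max 0 with hk₀
  set ℓmax := (H.map fun g => (kl g).2).foldr max 0 with hℓmax
  have hk₀le : ∀ g ∈ H, (kl g).1 ≤ k₀ := fun g hg => le_foldr_max_of_mem (List.mem_map.2 ⟨g, hg, rfl⟩)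
  have hℓle : ∀ g ∈ H, (kl g).2 ≤ ℓmax := fun g hg => le_foldr_max_of_mem (List.mem_map.2 ⟨g, hg, rfl⟩)
  obtain ⟨m, hmk₀, n₁, hmn₁, hfaceM⟩ := hface (δ ^ 2) hη k₀
  obtain ⟨n₂, huniq⟩ := exists_forall_le_lt_real_siteUniqZoneAt (d := d) p hp0 m hη
  set M := max n₁ n₂ with hM
  have hmM : m ≤ M := (le_of_lt hmn₁).trans (le_max_left _ _)
  have hmM' : m < M := hmn₁.trans_le (le_max_left _ _)
  -- the number of seeds `k`, of contacts `N`, of levels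
  set q : ℝ := 1 - (p : ℝ) ^ siteSeedBound d M with hq
  have hq1 : q < 1 := by rw [hq]; linarith [pow_pos hp0 (siteSeedBound d M)]
  obtain ⟨k, hk⟩ := exists_pow_lt_of_lt_one hδpos hq1
  set N := LData.Ncont d M k with hN
  set K₀ : ℝ := 1 / (1 - (p : ℝ)) ^ (2 * d * N) with hK₀
  set Lcount : ℕ := ⌈K₀ / δ⌉₊ + 1 with hLcount
  set j₀ : ℕ := 2 * M + 2 with hj₀
  set j₁ : ℕ := j₀ + Lcount - 1 with hj₁
  set R : ℕ := j₁ + M + ℓmax + 2 with hR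
  refine ⟨R, fun w Sfin D lo hi T o hfin hsub hDS ho hoD hBR htgt hTD hTne hreach => ?_⟩
  set μ := prodBernoulli w with hμ
  have hlohi : lo ≤ hi := by
    by_contra hlt
    have : Finset.Icc lo hi = ∅ := Finset.Icc_eq_empty hlt
    rw [this] at hreach
    simp only [Finset.notMem_empty, Set.iUnion_of_empty, Set.iUnion_empty, measureReal_empty] at hreach
    linarith
  -- the level data and hypotheses
  set L : LData d := ⟨lo, hi, o, Sfin⟩ with hLdef
  have hL : SLHyp L w p D (R - 1) :=
    { sub := hsub
      fin := hfin
      DS := hDS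
      encl := by
        have : R - 1 + 1 = R := by omega
        rw [this]; exact hBR
      o_not := hoD
      o_mem := ho }
  -- Step II
  have hj₁R : j₁ ≤ R - 1 := by omega
  have hcard : ((Finset.Icc j₀ j₁).card : ℝ) = Lcount := by
    rw [Nat.card_Icc]; congr 1; omega
  have hJ : 1 / (1 - (p : ℝ)) ^ (2 * d * N) ≤ δ * ((Finset.Icc j₀ j₁).card : ℝ) := by
    rw [hcard, hLcount]
    push_cast
    have h1 : K₀ / δ ≤ ⌈K₀ / δ⌉₊ := Nat.le_ceil _
    have h2 : K₀ = δ * (K₀ / δ) := by field_simp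
    rw [← hK₀]
    nlinarith
  have hreach' : 1 - δ < μ.real (sReachB L) := hreach
  obtain ⟨j, hjJ, hII⟩ := hL.stepII hp1 (N := N) hj₁R hJ hreach'
  obtain ⟨hj₀j, hjj₁⟩ := Finset.mem_Icc.1 hjJ
  have hjR : j ≤ R - 1 + 1 := by omega
  have hjM : 2 * M + 2 ≤ j := hj₀j
  have hwide : ∀ k', L.Lo j k' + 2 * M + 2 ≤ L.Hi j k' := by
    intro k'
    simp only [LData.Lo, LData.Hi, Pi.sub_apply, Pi.add_apply, Pi.natCast_apply]
    have : L.lo k' ≤ L.hi k' := hlohi k'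
    omega
  -- the shell
  set S := L.X (j - 1) \ L.X (j - (2 * M + 2)) with hSdef
  have hS : S ⊆ Finset.Icc (L.Lo j + 1) (L.Hi j - 1) := LData.shell_subset_shrink (by omega)
  have hSD : S ⊆ D := fun z hz => hL.mem_D_of_mem_X (show j - 1 ≤ R - 1 + 1 by omega) (Finset.sdiff_subset hz)
  -- Step III input
  have hIII : (1 - (p : ℝ) ^ siteSeedBound d M) ^ k ≤ δ := hk.le
  -- the faces lie in the shell
  have hUS : ∀ x ∈ outerBoundary (zdGraph d) (L.X j), L.ufaceX j M x ⊆ S := by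
    intro x hx
    obtain ⟨h, -⟩ := LData.winData_spec hwide hx
    refine (uface_subset_cube h).trans ?_
    change L.cubeX j M x ⊆ S
    rw [LData.cubeX_eq_ball]
    exact LData.ball_vX_subset_shell hjM hwide hx
  -- Step IV at every contact vertex: a relay reliable to `T` inside `D`
  have hIV : ∀ x ∈ outerBoundary (zdGraph d) (L.X j),
      1 - 3 * δ ≤ μ.real {ω | ∃ u ∈ L.ufaceX j M x,
        1 - δ < (prodBernoulli (pinW w (↑S : Set (Site d)) ω)).real
          (⋃ t ∈ T, siteConnIn (zdGraph d) (↑D : Set (Site d)) u t)} := by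
    intro x hx
    set v := L.vX j M x with hv
    have hballS : GM.ball v M ⊆ S := LData.ball_vX_subset_shell hjM hwide hx
    have hballD : (↑(GM.ball v M) : Set (Site d)) ⊆ ↑D := Finset.coe_subset.2 (hballS.trans hSD)
    -- the target route from `v`
    have hvB : v ∈ Finset.Icc (lo - (R : Site d)) (hi + (R : Site d)) := by
      have := LData.vX_mem (L := L) (by omega) hwide hx
      exact Icc_enlarge_mono (show j - 1 ≤ R by omega) this
    obtain ⟨ℓ, hRℓ, g, hg, hQ, hF⟩ := htgt.hit v hvB
    have hMℓ : M < ℓ := lt_of_lt_of_le (by omega) hRℓ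
    -- (1) uniqueness zone
    have h1 : 1 - δ ^ 2 < μ.real (siteUniqZoneAt v m M) := by
      rw [hμ, hsub.real_eq_sitePercolation hballD (determinedBy_siteUniqZoneAt v m M)
        (measurableSet_siteUniqZoneAt v m M)]
      exact huniq M (le_max_right _ _) v
    -- (2) the face
    have h2 : 1 - δ ^ 2 < μ.real (siteLinkIn (↑(GM.ball v M)) (GM.ball v m) (L.ufaceX j M x)) := by
      obtain ⟨a, τ, hsubU⟩ := LData.orthantFace_image_subset_ufaceX hwide hx
      have hmono : siteLinkIn (↑(GM.ball v M)) (GM.ball v m) ((orthantFace a τ M).image (· + v)) ⊆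
          siteLinkIn (↑(GM.ball v M)) (GM.ball v m) (L.ufaceX j M x) := siteLinkIn_mono le_rfl le_rfl hsubU
      refine lt_of_lt_of_le ?_ (measureReal_mono hmono)
      rw [hμ, hsub.real_eq_sitePercolation hballD (determinedBy_siteLinkIn _ _ _) (measurableSet_siteLinkIn _ _ _)]
      have e1 : GM.ball v M = (box d M).image (· + v) := rfl
      have e2 : GM.ball v m = (box d m).image (· + v) := rfl
      rw [e1, e2, real_siteLinkIn_image_add]
      exact hfaceM M (le_max_left _ _) a τ
    -- (3) the target route
    have h3 : 1 - δ ^ 2 < μ.real (siteLinkIn (↑(g.Qset ℓ v)) (GM.ball v m) (g.Fset ℓ v)) := by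
      rw [hμ, hsub.real_eq_sitePercolation (Finset.coe_subset.2 hQ) (determinedBy_siteLinkIn _ _ _)
        (measurableSet_siteLinkIn _ _ _)]
      have e2 : GM.ball v m = (box d m).image (· + v) := rfl
      rw [g.Qset_eq_image ℓ v, g.Fset_eq_image ℓ v, e2, real_siteLinkIn_image_add]
      exact hklspec g hg m ((hk₀le g hg).trans hmk₀) ℓ ((hℓle g hg).trans (by omega))
    exact stepIV_in (S := S) hF hmM hballS (LData.ufaceX_subset_innerBoundary hwide hx)
      (g.disjoint_Fset_ball hMℓ v) hδpos (Rg := (↑D : Set (Site d))) hballD (Finset.coe_subset.2 hQ) h1 h2 h3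
  -- the gluing hypothesis in the required form: source `o ∉ D`, relays reliable to `T` inside `D`
  have hC3' : ∀ (w' : Site d → unitInterval), SiteFinSupp w' L.Sfin → ∀ (A : Finset (Site d)), A ⊆ L.Sfin →
      1 - δc < (prodBernoulli w').real (⋃ a ∈ A, siteConn (zdGraph d) L.o a) →
      (∀ a ∈ A, 1 - δc < (prodBernoulli w').real (⋃ t ∈ T, siteConnIn (zdGraph d) (↑D : Set (Site d)) a t)) →
      1 - ε / 2 < (prodBernoulli w').real (⋃ t ∈ T, siteConn (zdGraph d) L.o t) := by
    intro w' hw' A hA hoA haT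
    have hle : 1 - δ₀ ≤ 1 - δc := by linarith [min_le_left δ₀ 1]
    exact hC3 (Site d) (zdGraph d) w' L.Sfin hw'.zero A T L.o (↑D : Set (Site d)) hA (hTD.trans hDS) ho hTne
      (fun h => hoD (Finset.mem_coe.1 h)) (hle.trans_lt hoA) fun a ha => hle.trans_lt (haT a ha)
  -- Step V
  exact hL.stepV_in (Rg := (↑D : Set (Site d))) hjR hwide hS hSD hε hε1 hδpos hδc' h3δ h12 hII hIII hUS
    hIV hC3'

end SiteKN

end Summit.CriticalPhenomena.PercolationContinuityZ3.Theorems.Transplant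

end
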